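/-
COR-CM (cell pub-hodgecm2) — Δ2 BRIDGE, VERSION-B item (1)(b) «Ω-PIN AT δ′», sequel of `CorCM/D2Bridge/OmegaPinAtLiuIndex.lean`: THE KEY OF
RECORD.  Seat prover-pub-hodgecm2-d2bridge-prove-7-g0-0, 2026-08-23.  THEOREMS ONLY (assembler DECISION #10); no definition, no named fact; nothing landed is edited or restated.
HC_CM is NOT proved; «Δ2 BRIDGE CLOSED» is NOT claimed; hLiu = «[Liu21] Thm 4.18 at the constructed objects AS A READING (r8)».
-/
import Summits.HodgeConjecture.CorCM.D2Bridge.OmegaPinAtLiuIndex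
import Summits.HodgeConjecture.CorCM.B01.Transposition.Item6CentralTypeAtPinIndex
import Summits.HodgeConjecture.HodgeCM.Model.LiuDictionaryPinEq
import HarnessLib

/-!
# Ω-pin at δ′ — the key OF RECORD at the pinned dictionary `liuDictionaryPin … V (I V (repAt a₀) (muLiu ι₁ rep)) (line …)`

At the index of record (`ρ := LiuIndex.repAt a₀`, `μ₀ := LiuIndex.muLiu ι₁ GramClass.rep`, under E's `hemb : (mk ι₁).embedding = ι₁`) the good
lines are the CONTINUOUS ones (`Good i := Continuous i.2.1`, pin-3's junction choice; the others have `block = ⊥`, own-htheta's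
`Item6BlockVanishing`), and X3-Char item (E) (pin-3 `Transposition/Item6CentralTypeAtPinIndex`) says that EVERY continuous index line `i` carries a
conjugate-symplectic WEIGHT-ONE `μ` with `Φ_μ = (line i).lineType` and `(line i).s = ι_{toHecke μ}` — exactly the `key` binder of
`OmegaPin.exists_pinTerms[_update]`.  So at the pinned dictionary of record the Ω-slot `σ ∕ hσ ∕ e ∕ he` of `PinSignatures.thm418C_ofTower_of_pins`
(+ the `hadm` seam `HasCMType μ_i (line i).lineType`) is INHABITED outright, for the per-line rests of DECISION #9 (`R ∕ hR` binders; sections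
`Rep.update Rep.ofLineOf (locF u_{a_i}) u_{a_i} rfl` = F5's `repOfLine a_i`): `exists_pinTerms_indexOfRecord`.  Nothing else enters; in particular no Hasse-type input.
HC_CM is NOT proved.
-/

set_option autoImplicit false

noncomputable section

open scoped TensorProduct Matrix

namespace HodgeCM.Model.LiuIndex.OmegaPin

open NumberField NumberField.InfinitePlace IsDedekindDomain
open Literature.AlgebraicGeometry.Motives
open Literature.AlgebraicGeometry.ShimuraVarieties
open Literature.AlgebraicGeometry.ShimuraVarieties.UnitaryCanonicalModel
open Literature.NumberTheory.Automorphic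
open Literature.NumberTheory.Automorphic.IdeleClassGroup
open Literature.NumberTheory.Automorphic.Liu2021
open Literature.NumberTheory.Automorphic.Liu2021.AppendixC
open Literature.NumberTheory.Automorphic.Liu2021.Def411WeilCarriers (JW TW locF Rep Eps)
open Literature.NumberTheory.Automorphic.Liu2021.Def411WeilCarriersDoubling
open Literature.NumberTheory.GelbartRogawski1991 Literature.NumberTheory.GelbartRogawski1991.UnitaryDualPair
open Literature.RepresentationTheory.Liu2021 (isOscillatorChar_toHeckeCharacter_iff)
open Summit.HodgeConjecture.CorCM
open Summit.HodgeConjecture.CorCM.Transposition.OmegaTransport (realUnit)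
open Summit.HodgeConjecture.CorCM.Transposition.CentralTypeAtPin (exists_weightOne_line_s_eq_chiSplittingLine_toHeckeCharacter)
open HodgeCM.Model.ArchSideTerm (e₁)

variable {L : HodgeCM.CMField} {ι₁ : (L : Type) →+* ℂ} (V : HodgeCM.HermSpace3 L ι₁) (a₀ : RealScalar L)

/-- **THE KEY OF RECORD** — at `ρ := repAt a₀`, `μ₀ := muLiu ι₁ GramClass.rep`, under `hemb`, every CONTINUOUS index line `i` of the pinned
dictionary of record has a conjugate-symplectic WEIGHT-ONE `μ` with `Φ_μ = (line i).lineType` and `(line i).s = ι_{toHecke μ}`: pin-3's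
X3-Char theorem `exists_weightOne_line_s_eq_chiSplittingLine_toHeckeCharacter` at the two sections of `GramClass.mk` (`repAt_spec a₀`,
`GramClass.mk_rep`), in the spelling of `OmegaPin.exists_pinTerms`'s `key` (the third argument of `chiSplittingLine` is a proof).
[cite: Liu2021, Def. 4.1 ∕ 4.3, Def. 4.12 (FJcycle.tex l. 2102–2108), Prop. 4.13 (l. 2113–2119), App. D §D.1 Step 2 (l. 5219)] -/
theorem key_indexOfRecord (hemb : (InfinitePlace.mk ι₁).embedding = ι₁) (i : I V (repAt a₀) (muLiu ι₁ GramClass.rep))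
    (_hi : SplitLine.PhiMuLine ι₁ (line V (repAt a₀) (muLiu ι₁ GramClass.rep) i))
    (hg : Continuous (i.2.1 : SplittingAt V (repAt a₀ i.1))) :
    ∃ (μ : Literature.NumberTheory.Automorphic.IdeleClassGroup (L : Type) →ₜ* Circle) (hμ : IsConjugateSymplectic (L : Type) μ),
      HasWeight (L : Type) μ 1 ∧ HasCMType (L : Type) μ (line V (repAt a₀) (muLiu ι₁ GramClass.rep) i).lineType ∧
        (line V (repAt a₀) (muLiu ι₁ GramClass.rep) i).s =
          chiSplittingLine (L : Type) e₁ (frameD V) (frameD_real V) (frameD_ne V) (toHeckeCharacter (L : Type) μ)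
            (isUnitary_toHeckeCharacter (L : Type) μ) ((isOscillatorChar_toHeckeCharacter_iff μ).mpr hμ)
            (realDiagonal (L : Type) (RealScalar.vec (repAt a₀ i.1)) (RealScalar.vec_real (repAt a₀ i.1)))
            (isUnit_det_realDiagonal (L : Type) (RealScalar.vec (repAt a₀ i.1)) (RealScalar.vec_real (repAt a₀ i.1))
              (RealScalar.vec_ne (repAt a₀ i.1)))
            (Matrix.diagonal (RealScalar.vec (repAt a₀ i.1)))
            (realDiagonal_map (L : Type) (RealScalar.vec (repAt a₀ i.1)) (RealScalar.vec_real (repAt a₀ i.1))).symm :=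
  exists_weightOne_line_s_eq_chiSplittingLine_toHeckeCharacter V (repAt a₀) GramClass.rep (fun q => repAt_spec a₀ q)
    GramClass.mk_rep hemb i hg

section Packaging


/-- **THE Ω-SLOT AT THE PINNED DICTIONARY OF RECORD, INHABITED** (`Good i := Continuous i.2.1`, sections `Rep.update Rep.ofLineOf (locF u_{a_i}) u_{a_i} rfl` (= F5's `repOfLine a_i`), rests the
composition's `R i hi hg μ hμ hw` identified by `hR` with the δ′ rest at `Rep.update Rep.ofLineOf (locF u_{a_i}) u_{a_i} rfl`): families `μ ∕ hμ ∕ hw` (weight-one characters OF THE LINES, from X3-Char) and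
`σ ∕ e` with `hσ`, `he` and the `hadm` seam — `OmegaPin.exists_pinTerms_update` at `key_indexOfRecord`.  These are the binder group (b)
of `PinSignatures.thm418C_ofTower_of_pins` at `Char := I V (repAt a₀) (muLiu ι₁ rep)`, `Adm i := {χ ∕∕ (line i).IsAutChar χ}`, `χof i a := a.1`,
`PhiMu i := PhiMuLine ι₁ (line i)` (the literal `liuDictionaryPin`, `rfl`).  HC_CM is NOT proved; «Δ2 BRIDGE CLOSED» is NOT claimed.
[cite: Liu2021, Thm. 4.18 (FJcycle.tex l. 2232–2237), Def. 4.11 (l. 2088–2096), Def. 4.12 (l. 2102–2108), Prop. 4.13 (l. 2113–2119), App. D §D.1 Steps 1–3 (l. 5215–5221)]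
[cite: GelbartRogawski1991, §3.1 Prop. 3.1.1 p. 455 L1–3] -/
theorem exists_pinTerms_indexOfRecord
    (ιV : ↥V.adelicFin →*
      ↥(UnitaryGroup.finAdelic (↥(maximalRealSubfield (L : Type))) (L : Type) (IsCMField.complexConj (L : Type)) 3
        (Matrix.diagonal (frameD V))))
    (h : exists_recordSystem) [IsGalois ℚ (L : Type)] (h6 : 6 ≤ Module.finrank ℚ (L : Type)) (Φ : CMType (L : Type))
    (hemb : (InfinitePlace.mk ι₁).embedding = ι₁)
    (R : ∀ (i : I V (repAt a₀) (muLiu ι₁ GramClass.rep))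
      (_ : SplitLine.PhiMuLine ι₁ (line V (repAt a₀) (muLiu ι₁ GramClass.rep) i))
      (_ : Continuous (i.2.1 : SplittingAt V (repAt a₀ i.1)))
      (μ : Literature.NumberTheory.Automorphic.IdeleClassGroup (L : Type) →ₜ* Circle) (_ : IsConjugateSymplectic (L : Type) μ)
      (_ : HasWeight (L : Type) μ 1),
      Thm418Rest (Model.sec42DataOf h Model.isoOf ⟨L.K⟩ ι₁ ⟨V.Hm, V.isHermitian, V.signature_ι₁, V.posDef_of_ne⟩ Φ))
    (hR : ∀ (i : I V (repAt a₀) (muLiu ι₁ GramClass.rep))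
      (hi : SplitLine.PhiMuLine ι₁ (line V (repAt a₀) (muLiu ι₁ GramClass.rep) i))
      (hg : Continuous (i.2.1 : SplittingAt V (repAt a₀ i.1)))
      (μ : Literature.NumberTheory.Automorphic.IdeleClassGroup (L : Type) →ₜ* Circle) (hμ : IsConjugateSymplectic (L : Type) μ)
      (hw : HasWeight (L : Type) μ 1),
      Model.restOfCharDeltaPrime h ⟨L.K⟩ h6 ι₁ ⟨V.Hm, V.isHermitian, V.signature_ι₁, V.posDef_of_ne⟩ Φ e₁ (frameD V) (frameD_real V)
        (frameD_ne V) ιV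
        (Rep.update ↥(maximalRealSubfield (L : Type)) (imagUnitSq (L : Type))
          (Rep.ofLineOf ↥(maximalRealSubfield (L : Type)) (imagUnitSq (L : Type)))
          (locF ↥(maximalRealSubfield (L : Type)) (imagUnitSq (L : Type))
            (realUnit ⟨L.K⟩ (repAt a₀ i.1).1 (repAt a₀ i.1).2.1 (repAt a₀ i.1).2.2))
          (realUnit ⟨L.K⟩ (repAt a₀ i.1).1 (repAt a₀ i.1).2.1 (repAt a₀ i.1).2.2) rfl)
        μ hμ hw = R i hi hg μ hμ hw) :
    ∃ (μ : ∀ i : I V (repAt a₀) (muLiu ι₁ GramClass.rep),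
        SplitLine.PhiMuLine ι₁ (line V (repAt a₀) (muLiu ι₁ GramClass.rep) i) → Continuous (i.2.1 : SplittingAt V (repAt a₀ i.1)) →
          (Literature.NumberTheory.Automorphic.IdeleClassGroup (L : Type) →ₜ* Circle))
      (hμ : ∀ (i : I V (repAt a₀) (muLiu ι₁ GramClass.rep))
        (hi : SplitLine.PhiMuLine ι₁ (line V (repAt a₀) (muLiu ι₁ GramClass.rep) i))
        (hg : Continuous (i.2.1 : SplittingAt V (repAt a₀ i.1))), IsConjugateSymplectic (L : Type) (μ i hi hg))
      (hw : ∀ (i : I V (repAt a₀) (muLiu ι₁ GramClass.rep))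
        (hi : SplitLine.PhiMuLine ι₁ (line V (repAt a₀) (muLiu ι₁ GramClass.rep) i))
        (hg : Continuous (i.2.1 : SplittingAt V (repAt a₀ i.1))), HasWeight (L : Type) (μ i hi hg) 1)
      (σ : ∀ (i : I V (repAt a₀) (muLiu ι₁ GramClass.rep))
        (hi : SplitLine.PhiMuLine ι₁ (line V (repAt a₀) (muLiu ι₁ GramClass.rep) i))
        (hg : Continuous (i.2.1 : SplittingAt V (repAt a₀ i.1))),
        {χ : (line V (repAt a₀) (muLiu ι₁ GramClass.rep) i).CharW // (line V (repAt a₀) (muLiu ι₁ GramClass.rep) i).IsAutChar χ} →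
          (toThm418Data _ (R i hi hg (μ i hi hg) (hμ i hi hg) (hw i hi hg))).AdmIndex)
      (e : ∀ (i : I V (repAt a₀) (muLiu ι₁ GramClass.rep))
        (hi : SplitLine.PhiMuLine ι₁ (line V (repAt a₀) (muLiu ι₁ GramClass.rep) i))
        (hg : Continuous (i.2.1 : SplittingAt V (repAt a₀ i.1)))
        (a : {χ : (line V (repAt a₀) (muLiu ι₁ GramClass.rep) i).CharW //
          (line V (repAt a₀) (muLiu ι₁ GramClass.rep) i).IsAutChar χ}),
        (line V (repAt a₀) (muLiu ι₁ GramClass.rep) i).Ω ιV a.1 ≃ₗ[ℂ]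
          (toThm418Data _ (R i hi hg (μ i hi hg) (hμ i hi hg) (hw i hi hg))).omegaAt (σ i hi hg a)),
      (∀ (i : I V (repAt a₀) (muLiu ι₁ GramClass.rep))
          (hi : SplitLine.PhiMuLine ι₁ (line V (repAt a₀) (muLiu ι₁ GramClass.rep) i))
          (hg : Continuous (i.2.1 : SplittingAt V (repAt a₀ i.1))),
          HasCMType (L : Type) (μ i hi hg) (line V (repAt a₀) (muLiu ι₁ GramClass.rep) i).lineType) ∧
      (∀ (i : I V (repAt a₀) (muLiu ι₁ GramClass.rep))
          (hi : SplitLine.PhiMuLine ι₁ (line V (repAt a₀) (muLiu ι₁ GramClass.rep) i))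
          (hg : Continuous (i.2.1 : SplittingAt V (repAt a₀ i.1))), Function.Injective (σ i hi hg)) ∧
      (∀ (i : I V (repAt a₀) (muLiu ι₁ GramClass.rep))
          (hi : SplitLine.PhiMuLine ι₁ (line V (repAt a₀) (muLiu ι₁ GramClass.rep) i))
          (hg : Continuous (i.2.1 : SplittingAt V (repAt a₀ i.1)))
          (a : {χ : (line V (repAt a₀) (muLiu ι₁ GramClass.rep) i).CharW //
            (line V (repAt a₀) (muLiu ι₁ GramClass.rep) i).IsAutChar χ})
          (g : ↥V.adelicFin) (m : (line V (repAt a₀) (muLiu ι₁ GramClass.rep) i).Ω ιV a.1),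
          e i hi hg a (MonoidAlgebra.of ℂ ↥V.adelicFin g • m) =
            (toThm418Data _ (R i hi hg (μ i hi hg) (hμ i hi hg) (hw i hi hg))).rhoAt (σ i hi hg a) g (e i hi hg a m)) :=
  exists_pinTerms_update V (repAt a₀) (muLiu ι₁ GramClass.rep) ιV h h6 Φ
    (fun i => Continuous (i.2.1 : SplittingAt V (repAt a₀ i.1))) (key_indexOfRecord V a₀ hemb) R hR

end Packaging

end HodgeCM.Model.LiuIndex.OmegaPin

end
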